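import Mathlib
import HarnessLib
import Literature.MathematicalPhysics.QuantumLattice.AnisotropicSectorSupport
import Summits.HubbardSuperconductivity.HubbardSuperconductivity.Theorems.KLProgrammePerturbedFermiCurveTwoFrame
import Summits.HubbardSuperconductivity.HubbardSuperconductivity.Theorems.KLProgrammeH10TwoPointLimitFrameTorusBridge
import Summits.HubbardSuperconductivity.HubbardSuperconductivity.Theorems.KLProgrammeH10TwoPointLimitFrameFermiPoint
import Summits.HubbardSuperconductivity.HubbardSuperconductivity.Theorems.KLProgrammeKLRegimeSplitFrameDist
import Summits.HubbardSuperconductivity.HubbardSuperconductivity.Theorems.KLProgrammeKLRegimeSplitSymInterp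
import Summits.HubbardSuperconductivity.HubbardSuperconductivity.Theorems.KLProgrammeKLRegimeSplitLegVertex

/-!
# Route `KLProgramme` — K3's ENGINE child (gen 4: `KLRegimeEngineV12`, stmt-HubbardSuperconductivity-19855), two-leg stubs
# `stub_twoLeg_scale0` / `stub_twoLeg_step`: READING the two-leg interpolant `S_n` on rays — the frame-keyed forms of
# `…PerturbedFermiCurveTwoFrame`, node exactness of `S_n` from (E0), and the SUPPLIER of (E3e) (`TwoLegSlopes`' normal-slope conjunct)
# from ONE gradient bound on `S_n`

Cell `gate-hubbard-kl`, seat p1b (g6).  The two-leg slot's (E3d/e) clause `TwoLegSlopes R … K n` (`…SplitTwoLegF`) asks, at every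
momentum `k⃗` of the scale-`n` shell `S_n = {|e_K| ≤ Λ_n}`, (E3d) `|z_n(k⃗) − 1| ≤ cz|U|` (field strength — a pure engine output) and
(E3e) `|klLocSelfEnergyRe … n k⃗ − ν_n(K)(θ(k⃗))| ≤ cz·|U|·|e_K(k⃗)|`, where `ν_n(K)(θ) = S_n(klFermiPoint μ K θ)` is the local part and
`S_n = symInterp L (klLocSelfEnergyRe … n)` the `C₄ᵥ`-symmetrised interpolant of the localised two-leg value.  The tree holds only
CONSUMERS of (E3e) (`…SplitLegVertex/LegLadder/LegDressing`).  This file supplies it from ONE number the expansion delivers anyway —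
a gradient bound `‖D(evalM S_n)‖ ≤ b` (e.g. `b = coeffNorm 1 S_n`, p1b's `norm_iteratedFDeriv_evalM_le_coeffNorm`, = the first position-space
moment of the scale-`n` two-leg kernel) — and the frame geometry:

* §1 the ray direction in `Momentum` has norm `1`; a gradient bound on `evalM S` over `Momentum` makes `p ↦ S.eval p` radially
  `b`-Lipschitz on every ray (`radialLipschitz_eval_of_norm_fderiv_evalM_le`); the frame correction `δ_K = −K` is radially
  `2A`-Lipschitz for a frame of `C²` size `A` (`radialLipschitz_frameShift`);
* §2 **node exactness of `S_n` from (E0)**: the data `klLocSelfEnergyRe … n` are even and `D₄`-symmetric, so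
  `S_n(p_k⃗) = klLocSelfEnergyRe … n k⃗` at every lattice momentum (`eval_symInterp_klLocSelfEnergyRe_latticeMomentum`; (E0) is p3's
  theorem `selfEnergySymmetric_all`, so this holds for every frame);
* §3 two frames: `|u_K(θ) − u_{K′}(θ)| ≤ frameDist K K′/(Dt_min − 2A)` (`abs_klFermiRadius_sub_le_frameDist`) and the (E3c) reading split
  `|S(k_F^K(θ)) − S′(k_F^{K′}(θ))| ≤ |S(k_F^{K′}(θ)) − S′(k_F^{K′}(θ))| + b·frameDist K K′/(Dt_min − 2A)` (`abs_eval_klFermiPoint_sub_le_of_frames`);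
* §4 off the curve, at a torus momentum of the tube: `|S(p_k⃗) − S(klFermiPoint μ K (θ(k⃗)))| ≤ b·|e_K(k⃗)|/(Dt_min − 2A)`
  (`abs_eval_latticeMomentum_sub_eval_klFermiPoint_le`) — the centred representative `c(k⃗) = s·dir θ(k⃗)` (`polar_repr`),
  `e_K(k⃗) = ε₀(c) + δ_K(c) − μ` (`nambuXiCT_eq_frameLevel`), and `…TwoFrame`'s off-curve inequality;
* §5 **the (E3e) supplier**: `TwoLegSlopes R … K n` from the field-strength bound (E3d) and `b ≤ cz·|U|·(Dt_min − 2A)`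
  (`twoLegSlopes_of_fieldStrength_of_gradient`), for a frame of `C²` size `A` with `2A < Dt_min` and the shell inside the level window
  (`[μ − A − Λ_n, μ + A + Λ_n] ⊂ [a, b]`).

Everything is PROVED; no definitions, no named facts; nothing about the Hubbard model is asserted (the gradient bound and (E3d) are
hypotheses — the engine's outputs).  References: BGM 2006 §2.4 Lemma 2.1 (2.40), (2.36) [cite: BenfattoGiulianiMastropietro2006];
HOME/prover-p2 Δ-INTERP (I-1) «the interpolant's derivatives are kernel moments».
-/

noncomputable section

namespace Summit.HubbardSuperconductivity.HubbardSuperconductivity.Theorems.KLRegimeSplit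

set_option linter.dupNamespace false -- summit = problem name (single-conjunct summit), D-0017

open Real Set
open Literature.MathematicalPhysics.QuantumLattice Literature.MathematicalPhysics.QuantumLattice.BandSectorCounting
open Literature.Probability.LatticeModels
open Summit.HubbardSuperconductivity.HubbardSuperconductivity.Theorems.DispersionFlow
open Summit.HubbardSuperconductivity.HubbardSuperconductivity.Theorems.PerturbedFermiCurve
open Summit.HubbardSuperconductivity.HubbardSuperconductivity.Theorems.KLProgrammeLegKernels

/-! ## §1 Radial Lipschitz bounds on rays: the reading function and the frame correction -/

/-- The ray direction read in `Momentum` has Euclidean norm `1`: `‖toLp (cos θ, sin θ)‖ = 1`. -/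
theorem norm_toLp_dir (θ : ℝ) : ‖(WithLp.toLp 2 (dir θ) : Momentum)‖ = 1 := by
  rw [EuclideanSpace.norm_eq, Fin.sum_univ_two]
  simp [dir, Real.cos_sq_add_sin_sq]

/-- `evalM S` is differentiable on `Momentum` (it is `−frameShift S`, smooth). -/
theorem differentiable_evalM (S : TrigPolyC4v) : Differentiable ℝ (evalM S) := by
  have h : evalM S = fun q => -frameShift S q := by
    funext q; simp [evalM_apply, frameShift]
  rw [h]
  exact ((contDiff_frameShift S (m := 1)).differentiable one_ne_zero).neg

/-- **A gradient bound on `evalM S` over `Momentum` makes `p ↦ S.eval p` radially `b`-Lipschitz on every ray**: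
`‖D(evalM S)(q)‖ ≤ b` for all `q` gives `|S(s·dir θ) − S(t·dir θ)| ≤ b·|s − t|` (chain rule along `r ↦ toLp (r·dir θ)`, whose
velocity `toLp (dir θ)` has norm `1`).  With `b = coeffNorm 1 S` this is fed by `norm_iteratedFDeriv_evalM_le_coeffNorm`. -/
theorem radialLipschitz_eval_of_norm_fderiv_evalM_le (S : TrigPolyC4v) {bS : ℝ}
    (hb : ∀ q : Momentum, ‖fderiv ℝ (evalM S) q‖ ≤ bS) (θ : ℝ) :
    ∀ s t : ℝ, s ∈ Icc 0 (π / ‖dir θ‖) → t ∈ Icc 0 (π / ‖dir θ‖) →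
      |S.eval (s • dir θ) - S.eval (t • dir θ)| ≤ bS * |s - t| := by
  intro s t hs ht
  set v : Momentum := WithLp.toLp 2 (dir θ) with hv
  set g : ℝ → ℝ := fun r => evalM S (r • v) with hg
  have hgr : ∀ r, g r = S.eval (r • dir θ) := fun r => by
    simp only [hg, hv, evalM_apply, ← WithLp.toLp_smul]
  have hinner : ∀ r : ℝ, HasDerivAt (fun r : ℝ => r • v) v r := fun r => by
    simpa using (hasDerivAt_id r).smul_const v
  have hderiv : ∀ r ∈ Icc 0 (π / ‖dir θ‖),
      HasDerivWithinAt g (fderiv ℝ (evalM S) (r • v) v) (Icc 0 (π / ‖dir θ‖)) r := fun r _ => by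
    have h := ((differentiable_evalM S) (r • v)).hasFDerivAt.comp_hasDerivAt r (hinner r)
    exact h.hasDerivWithinAt
  have hbound : ∀ r ∈ Icc 0 (π / ‖dir θ‖), ‖fderiv ℝ (evalM S) (r • v) v‖ ≤ bS := fun r _ => by
    refine ((fderiv ℝ (evalM S) (r • v)).le_opNorm v).trans ?_
    rw [hv, norm_toLp_dir, mul_one]
    exact hb _
  have h := (convex_Icc (0 : ℝ) (π / ‖dir θ‖)).norm_image_sub_le_of_norm_hasDerivWithin_le hderiv hbound ht hs
  rw [hgr, hgr, Real.norm_eq_abs, Real.norm_eq_abs] at h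
  exact h

/-- **The frame correction `δ_K = −K` of a frame of `C²` size `A` is radially `2A`-Lipschitz on every ray segment**
(p4's `radialLipschitz_of_fderiv_le` with `‖Dδ_K‖ ≤ 2A`, `norm_fderiv_frameShift_toLp_le`). -/
theorem radialLipschitz_frameShift {K : TrigPolyC4v} {A : ℝ}
    (hA : ∀ p : Momentum, ∀ j ≤ 2, ‖iteratedFDeriv ℝ j (frameShift K) p‖ ≤ A) (θ : ℝ) :
    ∀ s t : ℝ, s ∈ Icc 0 (π / ‖dir θ‖) → t ∈ Icc 0 (π / ‖dir θ‖) →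
      |frameShift K (WithLp.toLp 2 (s • dir θ)) - frameShift K (WithLp.toLp 2 (t • dir θ))| ≤ 2 * A * |s - t| :=
  radialLipschitz_of_fderiv_le
    (fun k _ => ((contDiff_frameShift_toLp K (m := 1)).differentiable one_ne_zero k))
    (fun k _ => norm_fderiv_frameShift_toLp_le hA k) θ

/-! ## §2 Node exactness of the two-leg interpolant from (E0) -/

/-- `s·r⁰ ∈ D₄` acts on torus sites as the axis reflection `(a, b) ↦ (a, −b)`. -/
theorem d4Site_sr_zero_eq {L : ℕ} (k : TorusSite 2 L) : d4Site (DihedralGroup.sr 0 : DihedralGroup 4) k = ![k 0, -k 1] := by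
  have h0 : ((0 : ZMod 4)).val = 0 := rfl
  simp only [d4Site, h0, Function.iterate_zero, id_eq, reflSite]

/-- `s·r³ ∈ D₄` acts on torus sites as the transposition `(a, b) ↦ (b, a)` (as the tree's `d4Site_sr_three`, reproved here to keep the
imports of the two-leg files free of the flux-stiffness modules). -/
theorem d4Site_sr_three_eq {L : ℕ} (k : TorusSite 2 L) : d4Site (DihedralGroup.sr 3 : DihedralGroup 4) k = ![k 1, k 0] := by
  have h3 : ((3 : ZMod 4)).val = 3 := rfl
  simp only [d4Site, h3, Function.iterate_succ, Function.iterate_zero, Function.comp_apply, id_eq, rotSite, reflSite]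
  funext j
  fin_cases j <;> simp

section Model

variable {L M : ℕ} [NeZero L] [NeZero M]

/-- Under (E0): **the localised two-leg value is even in the momentum**, `klLocSelfEnergyRe … n (−k⃗) = klLocSelfEnergyRe … n k⃗`. -/
theorem klLocSelfEnergyRe_neg {β U μ : ℝ} {K : TrigPolyC4v} {n : ℕ} (hE0 : SelfEnergySymmetric L M β U μ K n) (k : TorusSite 2 L) :
    klLocSelfEnergyRe L M β U μ K n (-k) = klLocSelfEnergyRe L M β U μ K n k := by
  rw [← klld_re_selfEnergy_eq_loc hE0 (-k) 0, ← klld_re_selfEnergy_eq_loc hE0 k 0, (hE0 k 0).2.2.1]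

/-- Under (E0): **the localised two-leg value is invariant under the axis reflection** `k⃗ ↦ (k₀, −k₁)`. -/
theorem klLocSelfEnergyRe_reflect {β U μ : ℝ} {K : TrigPolyC4v} {n : ℕ} (hE0 : SelfEnergySymmetric L M β U μ K n)
    (k : TorusSite 2 L) : klLocSelfEnergyRe L M β U μ K n ![k 0, -k 1] = klLocSelfEnergyRe L M β U μ K n k := by
  rw [← klld_re_selfEnergy_eq_loc hE0 _ 0, ← klld_re_selfEnergy_eq_loc hE0 k 0, ← d4Site_sr_zero_eq k,
    (hE0 k 0).2.2.2 (DihedralGroup.sr 0)]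

/-- Under (E0): **the localised two-leg value is invariant under the transposition** `k⃗ ↦ (k₁, k₀)`. -/
theorem klLocSelfEnergyRe_swap {β U μ : ℝ} {K : TrigPolyC4v} {n : ℕ} (hE0 : SelfEnergySymmetric L M β U μ K n)
    (k : TorusSite 2 L) : klLocSelfEnergyRe L M β U μ K n ![k 1, k 0] = klLocSelfEnergyRe L M β U μ K n k := by
  rw [← klld_re_selfEnergy_eq_loc hE0 _ 0, ← klld_re_selfEnergy_eq_loc hE0 k 0, ← d4Site_sr_three_eq k,
    (hE0 k 0).2.2.2 (DihedralGroup.sr 3)]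

/-- **Node exactness of the two-leg interpolant `S_n` under (E0)**: the `C₄ᵥ`-symmetrised interpolant of the localised two-leg value
READS the value at every lattice momentum, `(symInterp L (klLocSelfEnergyRe … n)).eval (p_k⃗) = klLocSelfEnergyRe … n k⃗` (p1b's
interpolation theorem `symInterp_eval_latticeMomentum` for `D₄`-symmetric data; (E0) holds for every frame by p3's
`selfEnergySymmetric_all`).  This is the harmless interpolation (I-1) of the two-leg side: no information is lost at the nodes. -/
theorem eval_symInterp_klLocSelfEnergyRe_latticeMomentum {β U μ : ℝ} {K : TrigPolyC4v} {n : ℕ}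
    (hE0 : SelfEnergySymmetric L M β U μ K n) (k : TorusSite 2 L) :
    (symInterp L (klLocSelfEnergyRe L M β U μ K n)).eval (latticeMomentum L k) = klLocSelfEnergyRe L M β U μ K n k :=
  symInterp_eval_latticeMomentum _ (klLocSelfEnergyRe_neg hE0) (klLocSelfEnergyRe_reflect hE0) (klLocSelfEnergyRe_swap hE0) k

end Model

/-! ## §3 Two frames: the reading point moves by at most `frameDist K K′/(Dt_min − 2A)` -/

section TwoFrames

variable {a b : ℝ} (B : BandBounds a b) {K K' : TrigPolyC4v} {A : ℝ}
  (hA : ∀ p : Momentum, ∀ j ≤ 2, ‖iteratedFDeriv ℝ j (frameShift K) p‖ ≤ A)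
  (hA' : ∀ p : Momentum, ∀ j ≤ 2, ‖iteratedFDeriv ℝ j (frameShift K') p‖ ≤ A)
  (hADt : 2 * A < B.Dtmin) {μ : ℝ} (hlo : a ≤ μ - A) (hhi : μ + A ≤ b)
include B hA hA' hADt hlo hhi

/-- **The frame's Fermi radius is `1/(Dt_min − 2A)`-Lipschitz in the frame** (sup distance `frameDist`): for two frames of `C²` size
`A` with `2A < Dt_min` and `[μ − A, μ + A] ⊂ [a, b]`, `|u_K(θ) − u_{K′}(θ)| ≤ frameDist K K′ / (Dt_min − 2A)` on every ray.
[cite: BenfattoGiulianiMastropietro2006, §2.4 Lemma 2.1 (2.40)] -/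
theorem abs_klFermiRadius_sub_le_frameDist (θ : ℝ) :
    |perturbedFermiRadius (fun k : Fin 2 → ℝ => frameShift K (WithLp.toLp 2 k)) μ θ -
        perturbedFermiRadius (fun k : Fin 2 → ℝ => frameShift K' (WithLp.toLp 2 k)) μ θ| ≤
      frameDist K K' / (B.Dtmin - 2 * A) :=
  abs_perturbedFermiRadius_sub_le B (continuous_frameShift_toLp K) (continuous_frameShift_toLp K')
    (fun k _ => abs_frameShift_toLp_le hA k) (fun k _ => abs_frameShift_toLp_le hA' k) hlo hhi
    (radialLipschitz_frameShift hA θ) hADt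
    (fun k _ => by
      rw [frameShift_toLp, frameShift_toLp, show -K.eval k - -K'.eval k = K'.eval k - K.eval k by ring, frameDist_comm]
      exact abs_eval_sub_le_frameDist K' K k)

/-- **The frame's Fermi point moves by at most `frameDist K K′/(Dt_min − 2A)`** (sup norm on `ℝ²`, `‖dir θ‖_∞ ≤ 1`):
`‖klFermiPoint μ K θ − klFermiPoint μ K′ θ‖ ≤ frameDist K K′ / (Dt_min − 2A)`. -/
theorem norm_klFermiPoint_sub_le_frameDist (θ : ℝ) :
    ‖klFermiPoint μ K θ - klFermiPoint μ K' θ‖ ≤ frameDist K K' / (B.Dtmin - 2 * A) := by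
  rw [klFermiPoint_eq, klFermiPoint_eq, ← sub_smul, norm_smul, Real.norm_eq_abs]
  have h := abs_klFermiRadius_sub_le_frameDist B hA hA' hADt hlo hhi θ
  have h0 : 0 ≤ |perturbedFermiRadius (fun k : Fin 2 → ℝ => frameShift K (WithLp.toLp 2 k)) μ θ -
      perturbedFermiRadius (fun k : Fin 2 → ℝ => frameShift K' (WithLp.toLp 2 k)) μ θ| := abs_nonneg _
  calc _ ≤ |perturbedFermiRadius (fun k : Fin 2 → ℝ => frameShift K (WithLp.toLp 2 k)) μ θ -
        perturbedFermiRadius (fun k : Fin 2 → ℝ => frameShift K' (WithLp.toLp 2 k)) μ θ| * 1 :=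
        mul_le_mul_of_nonneg_left (norm_dir_le_one θ) h0
    _ ≤ _ := by rw [mul_one]; exact h

/-- **(E3c)'s reading split for two frames**: for reading functions `S, S′ : TrigPolyC4v` with `p ↦ S.eval p` radially `b`-Lipschitz on
the ray `θ` (`b ≥ 0`; §1), `|S(k_F^K(θ)) − S′(k_F^{K′}(θ))| ≤ |S(k_F^{K′}(θ)) − S′(k_F^{K′}(θ))| + b·frameDist K K′/(Dt_min − 2A)` — what is
left of `FrameLipschitzG` for the engine is the frame-dependence of the reading function at a FIXED point. -/
theorem abs_eval_klFermiPoint_sub_le_of_frames (S S' : TrigPolyC4v) {bS : ℝ} (hbS : 0 ≤ bS) {θ : ℝ}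
    (hS : ∀ s t : ℝ, s ∈ Icc 0 (π / ‖dir θ‖) → t ∈ Icc 0 (π / ‖dir θ‖) →
      |S.eval (s • dir θ) - S.eval (t • dir θ)| ≤ bS * |s - t|) :
    |S.eval (klFermiPoint μ K θ) - S'.eval (klFermiPoint μ K' θ)| ≤
      |S.eval (klFermiPoint μ K' θ) - S'.eval (klFermiPoint μ K' θ)| + bS * (frameDist K K' / (B.Dtmin - 2 * A)) := by
  have hd : ∀ k : Fin 2 → ℝ, (∀ i, |k i| ≤ π) →
      |frameShift K (WithLp.toLp 2 k) - frameShift K' (WithLp.toLp 2 k)| ≤ frameDist K K' := fun k _ => by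
    rw [frameShift_toLp, frameShift_toLp, show -K.eval k - -K'.eval k = K'.eval k - K.eval k by ring, frameDist_comm]
    exact abs_eval_sub_le_frameDist K' K k
  have h := abs_apply_sub_apply_le_of_two_perturbations B (continuous_frameShift_toLp K) (continuous_frameShift_toLp K')
    (fun k _ => abs_frameShift_toLp_le hA k) (fun k _ => abs_frameShift_toLp_le hA' k) hlo hhi
    (radialLipschitz_frameShift hA θ) hADt hd (F := fun p => S.eval p) (F' := fun p => S'.eval p) hbS hS
  rw [klFermiPoint_eq, klFermiPoint_eq]
  exact h

end TwoFrames

/-! ## §4 Off the curve at a torus momentum of the tube -/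

section OffCurve

variable {a b : ℝ} (B : BandBounds a b) {K : TrigPolyC4v} {A : ℝ}
  (hA : ∀ p : Momentum, ∀ j ≤ 2, ‖iteratedFDeriv ℝ j (frameShift K) p‖ ≤ A)
  (hADt : 2 * A < B.Dtmin) {μ Λ : ℝ} (hloΛ : a ≤ μ - A - Λ) (hhiΛ : μ + A + Λ ≤ b) (hΛ : 0 ≤ Λ)
include B hA hADt hloΛ hhiΛ hΛ

/-- **Reading `S` at a torus momentum of the tube vs. at the curve point of its own ray**: for a frame of `C²` size `A` with
`2A < Dt_min` and `[μ − A − Λ, μ + A + Λ] ⊂ [a, b]`, a reading function `S` radially `b`-Lipschitz on every ray (`b ≥ 0`), and a torus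
momentum `k⃗` with `|e_K(k⃗)| ≤ Λ`: `|S(p_k⃗) − S(klFermiPoint μ K (θ(k⃗)))| ≤ b·|e_K(k⃗)|/(Dt_min − 2A)` — the centred representative of
`k⃗` is `s·dir θ(k⃗)` with free level `ε₀ = μ + e_K + K ∈ [a, b]`, and `…TwoFrame`'s off-curve inequality applies with `δ_K = −K`. -/
theorem abs_eval_latticeMomentum_sub_eval_klFermiPoint_le {L : ℕ} [NeZero L] (S : TrigPolyC4v) {bS : ℝ} (hbS : 0 ≤ bS)
    (hS : ∀ θ s t : ℝ, s ∈ Icc 0 (π / ‖dir θ‖) → t ∈ Icc 0 (π / ‖dir θ‖) →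
      |S.eval (s • dir θ) - S.eval (t • dir θ)| ≤ bS * |s - t|)
    {k : TorusSite 2 L} (hk : |nambuXiCT L μ K k| ≤ Λ) :
    |S.eval (latticeMomentum L k) - S.eval (klFermiPoint μ K (momentumAngle L k))| ≤
      bS * (|nambuXiCT L μ K k| / (B.Dtmin - 2 * A)) := by
  -- the centred representative in polar form
  set c : Fin 2 → ℝ := torusCentredMomentum L k with hc
  set θ : ℝ := polarAngle c with hθc
  set s : ℝ := ‖momToComplex c‖ with hs
  have hθ : momentumAngle L k = θ := rfl
  have hpol : s • dir θ = c := (polar_repr c).symm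
  have hs0 : 0 ≤ s := norm_nonneg _
  have hcn : ‖c‖ ≤ π := (pi_norm_le_iff_of_nonneg Real.pi_pos.le).2 fun i => by
    rw [Real.norm_eq_abs]; exact abs_torusCentredMomentum_le_pi L k i
  have hs1 : s * ‖dir θ‖ ≤ π := by rw [← norm_smul_dir hs0, hpol]; exact hcn
  -- `S` at the lattice momentum is `S` at the centred representative
  have hSc : S.eval (latticeMomentum L k) = S.eval c := by
    have h := frameShift_toLp_torusCentredMomentum L S k
    rw [frameShift_toLp] at h
    linarith
  -- the perturbed level at `c` is `e_K(k)`; the free level lies in the window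
  have hlev : rayDispersion (θ, s) + frameShift K (WithLp.toLp 2 (s • dir θ)) - μ = nambuXiCT L μ K k := by
    have h1 : rayDispersion (θ, s) = sqDispersion (s • dir θ) := rfl
    rw [h1, hpol, nambuXiCT_eq_frameLevel, frameLevel_toLp]
  have hAk := abs_le.1 (abs_frameShift_toLp_le hA (s • dir θ))
  have hek := abs_le.1 hk
  have hwin : rayDispersion (θ, s) ∈ Icc a b := by
    constructor <;> linarith [hlev]
  have hlo : a ≤ μ - A := by linarith
  have hhi : μ + A ≤ b := by linarith
  have h := abs_apply_sub_apply_perturbedFermiRadius_le B (continuous_frameShift_toLp K) (fun k _ => abs_frameShift_toLp_le hA k)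
    hlo hhi (radialLipschitz_frameShift hA θ) hADt hs0 hs1 hwin (F := fun p => S.eval p) hbS (hS θ)
  beta_reduce at h
  rw [hlev, hpol] at h
  rw [hSc, hθ, klFermiPoint_eq]
  exact h

end OffCurve

/-! ## §5 The (E3e) supplier -/

section Model

variable {L M : ℕ} [NeZero L] [NeZero M]

/-- **SUPPLIER of (E3d/e) `TwoLegSlopes` from the field-strength bound and ONE gradient bound on the two-leg interpolant.**  For a frame
`K` of `C²` size `A` (`‖Dʲδ_K‖ ≤ A`, `j ≤ 2`) with `2A < Dt_min` and the scale-`n` shell inside the level window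
(`[μ − A − Λ_n, μ + A + Λ_n] ⊂ [a, b]`, `B : BandBounds a b`): if (E0) holds at scale `n` (p3's `selfEnergySymmetric_all`), the
field strength satisfies `|z_n(k⃗) − 1| ≤ cz|U|` on the shell ((E3d), engine), and `S_n = symInterp L (klLocSelfEnergyRe … n)` has a
gradient bound `‖D(evalM S_n)‖ ≤ b` with `0 ≤ b ≤ cz·|U|·(Dt_min − 2A)` (engine: `b = coeffNorm 1 S_n` = the first moment of the scale-`n`
two-leg kernel), then `TwoLegSlopes R … K n`: at every shell momentum `|klLocSelfEnergyRe … n k⃗ − ν_n(K)(θ(k⃗))| ≤ cz·|U|·|e_K(k⃗)|`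
(node exactness §2 + off-curve reading §4). -/
theorem twoLegSlopes_of_fieldStrength_of_gradient {a b : ℝ} (B : BandBounds a b) {K : TrigPolyC4v} {A : ℝ}
    (hA : ∀ p : Momentum, ∀ j ≤ 2, ‖iteratedFDeriv ℝ j (frameShift K) p‖ ≤ A) (hADt : 2 * A < B.Dtmin)
    {R : RenConsts} {β U μ : ℝ} {n : ℕ}
    (hloΛ : a ≤ μ - A - klScale klE0 n) (hhiΛ : μ + A + klScale klE0 n ≤ b)
    (hE0 : SelfEnergySymmetric L M β U μ K n)
    (hz : ∀ k ∈ klShell L μ K n, |klFieldStrength L M β U μ K n k - 1| ≤ R.cz * |U|)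
    {bS : ℝ} (hbS : 0 ≤ bS)
    (hgrad : ∀ q : Momentum, ‖fderiv ℝ (evalM (symInterp L (klLocSelfEnergyRe L M β U μ K n))) q‖ ≤ bS)
    (hb : bS ≤ R.cz * |U| * (B.Dtmin - 2 * A)) :
    TwoLegSlopes L M R β U μ K n := by
  intro k hk
  refine ⟨hz k hk, ?_⟩
  have hkΛ : |nambuXiCT L μ K k| ≤ klScale klE0 n := by
    rw [klShell, mem_momentumShell] at hk; exact hk
  have hpos : 0 < B.Dtmin - 2 * A := sub_pos.2 hADt
  set S := symInterp L (klLocSelfEnergyRe L M β U μ K n) with hSdef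
  have hread := abs_eval_latticeMomentum_sub_eval_klFermiPoint_le B hA hADt hloΛ hhiΛ (by unfold klScale klE0; positivity) S hbS
    (fun θ => radialLipschitz_eval_of_norm_fderiv_evalM_le S hgrad θ) hkΛ
  rw [eval_symInterp_klLocSelfEnergyRe_latticeMomentum hE0] at hread
  have hloc : klLocalPart L M β U μ K n (momentumAngle L k) = S.eval (klFermiPoint μ K (momentumAngle L k)) := rfl
  rw [hloc]
  refine hread.trans ?_
  rw [mul_div_assoc', div_le_iff₀ hpos]
  have he : 0 ≤ |nambuXiCT L μ K k| := abs_nonneg _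
  calc bS * |nambuXiCT L μ K k| ≤ R.cz * |U| * (B.Dtmin - 2 * A) * |nambuXiCT L μ K k| :=
        mul_le_mul_of_nonneg_right hb he
    _ = R.cz * |U| * |nambuXiCT L μ K k| * (B.Dtmin - 2 * A) := by ring

end Model

end Summit.HubbardSuperconductivity.HubbardSuperconductivity.Theorems.KLRegimeSplit

end
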